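import Mathlib
import HarnessLib

/-!
# Crux `NoZenoR` (stmt-ResolutionOfSingularities-19943), row 8⁗ — RIGIDITY CORE: a linear map that sends a
# finite spanning set into itself injectively has finite order (why origin-rule seeds are never noetherian)

Route `ResolutionOfSingularities/HomologicalConductor`, chain W4.4, KERNEL-g18 §1 (lead g18).
`[OURS]` — AI-formalised, weaker than expert review; NOT a statement of any manuscript under review.

KERNEL-g18 LEMMA 1.1: a lattice automorphism `g ∈ GL(N)` with `gσ ⊆ σ` for a full-dimensional strongly convex
rational cone `σ` and `g w = w` for an interior RATIONAL `w` has finite order, hence `gσ = σ`; so the self-similar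
step `g : σ ≅ σ₁ ⊊ σ` of the ORIGIN RULE (KERNEL-g14 §3.7) fixes no interior rational ray: origin-rule Zeno seeds
run along IRRATIONAL Perron rays (non-noetherian valuation rings) and bear on `NoZenoR` only jointly with
`StrictDrop` (p617380), never through the vacuity coupling (p599841). The combinatorial heart, proved here over any
field: transpose to the dual cone — `h = gᵀ` maps `D = σ^∨ ∩ M` into itself and preserves the height `ℓ = ⟨·, w⟩`,
whose level sets `{m ∈ D : ℓ m ≤ c}` are FINITE (because `w` is interior) and span (because `σ^∨` is
full-dimensional); a linear map permuting a finite spanning set has finite order.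

* `exists_pow_restrict_eq_of_mapsTo_finite` — pigeonhole: if `f` maps a finite set `S` into itself injectively,
  some positive power of `f` fixes `S` pointwise;
* `exists_pos_pow_eq_one_of_mapsTo_finite_spanning` — if moreover `S` spans, that power of `f` is the identity;
* `exists_pos_pow_eq_one_of_levelSet` — the level-set form: `f` injective with `f(D) ⊆ D`, `ℓ ∘ f = ℓ` on `D`,
  a finite spanning level set `{x ∈ D | ℓ x ≤ c}` ⇒ `f` has finite order;
* `image_eq_of_pow_eq_one` — then `f '' D = D` (no PROPER self-similar step).

Elementary; recorded so that the chain's reading «row 8⁗ is a route question (DR-JOINT), never an item closer»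
(CHAIN v34 §0, KERNEL-g18 §1.3) rests on a checked lemma. The convex-geometric dictionary (`σ ↔ σ^∨`, finiteness
of lattice points under a positive height) is standard toric geometry and is not formalised here.
-/

-- single-problem summit: the doubled namespace component is forced
set_option linter.dupNamespace false

namespace Summit.ResolutionOfSingularities.ResolutionOfSingularities.Theorems.NoZeno.RigidityCore

open Function Set

variable {K V : Type*} [Field K] [AddCommGroup V] [Module K V]

/-- **Pigeonhole on a finite invariant set.** If a linear map `f` maps a finite set `S` into itself injectively,
then some positive power of `f` fixes every element of `S`. [folklore] -/
theorem exists_pow_restrict_eq_of_mapsTo_finite (f : V →ₗ[K] V) {S : Set V} (hS : S.Finite)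
    (hmap : MapsTo f S S) (hinj : InjOn f S) :
    ∃ N : ℕ, 0 < N ∧ ∀ s ∈ S, (f ^ N) s = s := by
  classical
  haveI : Finite S := hS.to_subtype
  -- the restriction of f to S, as a self-map of the finite type S
  let φ : S → S := fun s => ⟨f s, hmap s.2⟩
  have hφ : Injective φ := by
    intro a b h
    exact Subtype.ext (hinj a.2 b.2 (by simpa [φ] using congrArg Subtype.val h))
  -- an injective self-map of a finite type is a bijection, i.e. a permutation of finite order
  let e : Equiv.Perm S := Equiv.ofBijective φ (Finite.injective_iff_bijective.mp hφ)
  refine ⟨orderOf e, orderOf_pos e, fun s hs => ?_⟩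
  have hiter : ∀ n : ℕ, ∀ x : S, ((e ^ n) x : V) = (f ^ n) (x : V) := by
    intro n
    induction n with
    | zero => intro x; simp
    | succ n ih =>
      intro x
      rw [pow_succ', Equiv.Perm.mul_apply, pow_succ', Module.End.mul_apply, ← ih x]
      rfl
  have := hiter (orderOf e) ⟨s, hs⟩
  rw [pow_orderOf_eq_one] at this
  simpa using this.symm

/-- **A linear map permuting a finite spanning set has finite order.** [folklore] -/
theorem exists_pos_pow_eq_one_of_mapsTo_finite_spanning (f : V →ₗ[K] V) {S : Set V} (hS : S.Finite)
    (hspan : Submodule.span K S = ⊤) (hmap : MapsTo f S S) (hinj : InjOn f S) :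
    ∃ N : ℕ, 0 < N ∧ f ^ N = 1 := by
  obtain ⟨N, hN, hfix⟩ := exists_pow_restrict_eq_of_mapsTo_finite f hS hmap hinj
  refine ⟨N, hN, ?_⟩
  apply LinearMap.ext_on hspan
  intro s hs
  simpa using hfix s hs

/-- **Level-set form (the dual-cone picture).** Let `f` be an injective linear map with `f(D) ⊆ D` preserving a
height `ℓ` on `D` (`ℓ (f x) = ℓ x` for `x ∈ D`). If some level set `{x ∈ D | ℓ x ≤ c}` is finite and spans, then
`f` has finite order. Model: `D = σ^∨ ∩ M`, `f = gᵀ`, `ℓ = ⟨·, w⟩` with `g w = w`, `w` interior and rational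
(level sets finite by interiority, spanning since `σ^∨` is full-dimensional). [this work; KERNEL-g18 LEMMA 1.1] -/
theorem exists_pos_pow_eq_one_of_levelSet {L : Type*} [Preorder L] (f : V →ₗ[K] V) (hf : Injective f)
    {D : Set V} (hmap : MapsTo f D D) (ℓ : V → L) (hℓ : ∀ x ∈ D, ℓ (f x) = ℓ x) (c : L)
    (hfin : {x ∈ D | ℓ x ≤ c}.Finite) (hspan : Submodule.span K {x ∈ D | ℓ x ≤ c} = ⊤) :
    ∃ N : ℕ, 0 < N ∧ f ^ N = 1 := by
  refine exists_pos_pow_eq_one_of_mapsTo_finite_spanning f hfin hspan ?_ (hf.injOn)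
  intro x hx
  exact ⟨hmap hx.1, by rw [hℓ x hx.1]; exact hx.2⟩

/-- **No proper self-similar step.** If `f(D) ⊆ D` and `f ^ N = 1` for some `N > 0`, then `f '' D = D`: a map of
finite order cannot carry `D` onto a PROPER subset of itself. Model: `gσ = σ` (dually `gᵀ(σ^∨ ∩ M) = σ^∨ ∩ M`), so a
lattice isomorphism `σ ≅ σ₁ ⊊ σ` fixes no interior rational ray. [this work; KERNEL-g18 COROLLARY 1.2(i)] -/
theorem image_eq_of_pow_eq_one (f : V →ₗ[K] V) {D : Set V} (hmap : MapsTo f D D) {N : ℕ} (hN : 0 < N)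
    (hfN : f ^ N = 1) : f '' D = D := by
  apply Subset.antisymm hmap.image_subset
  intro x hx
  -- x = f (f^(N-1) x) and f^(N-1) x ∈ D
  have hmapPow : ∀ n : ℕ, MapsTo (f ^ n) D D := by
    intro n
    induction n with
    | zero => intro y hy; simpa using hy
    | succ n ih => intro y hy; rw [pow_succ', Module.End.mul_apply]; exact hmap (ih hy)
  refine ⟨(f ^ (N - 1)) x, hmapPow (N - 1) hx, ?_⟩
  have : f ((f ^ (N - 1)) x) = (f ^ N) x := by
    rw [← Module.End.mul_apply, ← pow_succ', Nat.sub_add_cancel hN]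
  rw [this, hfN, Module.End.one_apply]

end Summit.ResolutionOfSingularities.ResolutionOfSingularities.Theorems.NoZeno.RigidityCore
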